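/-
Origin: expansion seat `planner-pub-hodgecm-mc-axioms-1-g14-0`, handover #W253 2026-08-20T15:53:55Z md5 83bb162fa9e1 (PKG 12d44bb35dd1 → 83bb162fa9e1; 115 l.; MECHANICAL (iib-R) rewrite v3.1 of the PKG file as it stands (4 token edits; rules R1x1+RX[h₂]x3)) (`HOME/mc/pub-hodgecm-mc-axioms-1-g14/revendor/kit-r55/stage55/HodgeCM/Model/Binders/Gen12WedgeKTypeOfStrict.lean`, md5 83bb162fa9e1, 115 lines);
landed by the gen-22 packager (p-g22) in gate run 55 REPLACES the earlier landed copy of `HodgeCM/Model/Binders/Gen12WedgeKTypeOfStrict.lean` (seat copy carried the packager Origin header of an earlier run (stripped)).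
-/
/-
Origin: speedrun cell pub-hodgecm, MODEL-CONSTRUCTION sub-cell, unit pub-hodgecm-mc-binder-1-g8 (BINDER PROVER, gen 8; node
B2-meet, BINDER-OWNERS row 14 `gen12`, clause (SS-K) — the (x-Θ) hypotheses `hA`/`hB` of kit #12 `Gen12WedgeKType`), seat
prover-pub-hodgecm-mc-binder-1-g8-0, 2026-08-19.
Target in PKG: HodgeCM/Model/Binders/Gen12WedgeKTypeOfStrict.lean (NEW additive leaf; imports this lineage's kit #12
`Model/Binders/Gen12WedgeKType`, mc-theta-3-g9's (Θ-sat) row #S1 `Model/ThetaSpaceSat` (RUN 37; additive over RUN 35) and the vendored twin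
#V5 `Vendored/H21/AlgebraicGeometry/ShimuraVarieties/UnitaryBallCotangentWeightDual` of binder-1-g7's ACCEPTED tree file p191043; nothing
landed imports it).  KERNEL ONLY: 0 records, nothing cited, 0 `def … : Prop`, MODEL-N ±0, E unchanged.
-/
import Summits.HodgeConjecture.HodgeCM.Model.Binders.Gen12WedgeKType
import Summits.HodgeConjecture.HodgeCM.Model.ThetaSpaceSat
import Literature.AlgebraicGeometry.ShimuraVarieties.UnitaryBallCotangentWeightDual

/-!
# Row `gen12`, clause (SS-K): the (x-Θ) hypotheses `hA` / `hB` DISCHARGED for strict saturated situations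

Kit #12 `wedgeMem_of_kType adm gK χ τ op1 hSK m hdet hA hB` asks, for the admissible `K`-type situations of lines `0` / `1`, that their test
pairs `φ^i := j (ι (proj i))` transform under `((S V c).P k).ω (gK k, 1)` through ONE matrix `m k`.  With mc-theta-3-g9's (Θ-sat)
admissibility `adm Γ k Sit := Sit.IsSaturated (KΓ Γ) ∧ Sit.IsStrict` (`Model/ThetaSpaceSat`), the elements
`gK k := ιinf (u_k) · a_k` (`u_k ∈ Stab(x₀) ≤ U(2,1)` read at `ι₁`, `a_k` in every saturation group `KΓ Γ` — the compact factors at the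
places `≠ ι₁`, which lie in `awayFromCM ⊓ M_K` for every `K`) and `m k := Jac u_k x₀`, this is theta-3's (E4)
`KTypeSituation.IsStrict.act_family_arch_mul` followed by binder-1-g7's tree lemma `map_weightOf_dual_proj`
(`τ₁^∨ u (proj i) = Σ_l (Jac u x₀) l i • proj l`, tree p191043, twin #V5):

* **`omega_testPair_of_strict`** — for EVERY line `k₀`, `Γ`, strict `Sit` saturated at `KΓ Γ`, `j ∈ Sit.𝓙`, `u : Stab(x₀)`, `a ∈ KΓ Γ`:
  `((S V c).P k₀).ω (ιinf u * a, 1) (j (ι (proj i))) = Σ_l (Jac u x₀) l i • j (ι (proj l))`;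
* **`hA_of_strict` / `hB_of_strict`** — kit #12's `hA` (line `0`) and `hB` (line `1`) VERBATIM at `adm := IsSaturated ∧ IsStrict`,
  `gK k := ιinf (uOf k) * aOf k`, `m k := Jac (uOf k) x₀`, for any parametrisation `(uOf, aOf)` with `aOf k ∈ KΓ Γ` for all `Γ`
  (unitary-1's `archIsotropy` index is one such).
So (x-Θ) of BINDER-TRIAGE §63.2 is no longer a hypothesis of row 14; `hdet` then reads `det (Jac (uOf k) x₀) = isotropyDetChar (uOf k)`
(#V5 `det_Jac_x₀_eq_isotropyDetChar`) against (x-W)'s character `χ`.  Nothing here is a claim of the manuscripts under adjudication.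
-/

set_option autoImplicit false

noncomputable section

open MeasureTheory NumberField
open scoped InnerProductSpace Matrix

namespace HodgeCM.Model

open HodgeCM HodgeCM.Universe
open Literature.NumberTheory.Weil1964
open Literature.NumberTheory.Automorphic (weightForms)
open Literature.Geometry.ComplexHyperbolic.BallModel (U21 Ball x₀ Jac)
open Literature.AlgebraicGeometry.ShimuraVarieties
open Literature.AlgebraicGeometry.HodgeTheory
open Literature.NumberTheory.Automorphic.PicardCM
open Literature.NumberTheory.Transcendental (Arapura2012_Cor_15_4_6)
open HodgeCM.Model.ThetaSpace
open MulAction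

variable (hHD : exists_isReal_hodgeModel) (hI : hodgePQ_independent_of_hodgeModel)
  (h₁ : BallQuotientUniformised)  (h₃ : CMAbelianVarietyRealised)
variable (h : Bool) (hA : Arapura2012_Cor_15_4_6)
  (W : ∀ {L : CMField} {ι₁ : L →+* ℂ} (V : HermSpace3 L ι₁) (c : SeesawCtx L), WmInput V c.D)
  (S : ∀ {L : CMField} {ι₁ : L →+* ℂ} (V : HermSpace3 L ι₁) (c : SeesawCtx L), ThetaAdelicSide V c)
  (μ : ∀ {L : CMField}, SeesawCtx L → Fin 4 → InfinitePlace L → ℤ)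
variable {L : CMField} {ι₁ : L →+* ℂ} (V : HermSpace3 L ι₁) (c : SeesawCtx L) (hV : IsAnisotropic L V.Hm)

/-- the pinned theta-space INPUT of the context (kit #2 `pinX`) -/
local notation3 "𝕏" => pinX hHD hI h₁ h₃ S V c hV

/-- **The test pair of a strict saturated situation transforms through the Jacobian at the base point** (any line `k₀`): theta-3's (E4)
+ `map_weightOf_dual_proj` (the pin reads `κ₁ := Stab(x₀) ↪ U(2,1)`, `τ₁ := weightOf x₀`, and `(P k₀).ω` IS the Weil action of the pair's
theta-kernel datum). -/
theorem omega_testPair_of_strict (k₀ : Fin 4) (Γ : Level V) (KΓ : Subgroup (quotU V).G)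
    (Sit : KTypeSituation ((𝕏).P k₀) ((𝕏).ιinf Γ) ((𝕏).Δ Γ) (𝕏).κ₁ (𝕏).τ₁)
    (hsat : Sit.IsSaturated KΓ) (hst : Sit.IsStrict)
    {j : {j : Sit.E →ₗ[ℂ] ((𝕏).P k₀).weilDatum.ThetaTop // ((𝕏).P k₀).kernelDatum.IsThetaEquivariant Sit.κ Sit.σ j}}
    (hj : j ∈ Sit.𝓙) (u : stabilizer U21 x₀) {a : (V.latticeModel printFact_unitaryCompact_holds).G} (ha : a ∈ KΓ) (i : Fin 2) :
    ((S V c).P k₀).ω ((S V c).ιinf (u : U21) * a, 1) (j.1 (Sit.ι (LinearMap.proj i))) =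
      ∑ l, (Jac (u : U21) x₀) l i • j.1 (Sit.ι (LinearMap.proj l)) := by
  have hE4 := hst.act_family_arch_mul hsat hj u ha (LinearMap.proj i)
  have hJ := BallForms.map_weightOf_dual_proj (j.1 ∘ₗ Sit.ι) u i
  simp only [LinearMap.comp_apply] at hJ
  exact hE4.trans hJ

/-- **Kit #12's `hA` DISCHARGED** (line `0`) at `adm Γ k Sit := Sit.IsSaturated (KΓ Γ) ∧ Sit.IsStrict`, `gK k := ιinf (uOf k) * aOf k`,
`m k := Jac (uOf k) x₀`, for any parametrisation with `aOf k ∈ KΓ Γ` for every `Γ`. -/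
theorem hA_of_strict (KΓ : Level V → Subgroup (quotU V).G) {Kι : Type*} (uOf : Kι → stabilizer U21 x₀) (aOf : Kι → (V.latticeModel printFact_unitaryCompact_holds).G)
    (haOf : ∀ (Γ : Level V) (k : Kι), aOf k ∈ KΓ Γ) :
    ∀ (Γ : Level V)
      (Sit : KTypeSituation ((𝕏).P 0) ((𝕏).ιinf Γ) ((𝕏).Δ Γ) (𝕏).κ₁ (𝕏).τ₁),
      (Sit.IsSaturated (KΓ Γ) ∧ Sit.IsStrict) → ∀ j ∈ Sit.𝓙, ∀ (k : Kι) (i : Fin 2),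
        ((S V c).P 0).ω ((S V c).ιinf (uOf k : U21) * aOf k, 1) (j.1 (Sit.ι (LinearMap.proj i))) =
          ∑ l, (Jac (uOf k : U21) x₀) l i • j.1 (Sit.ι (LinearMap.proj l)) :=
  fun Γ Sit hadm _ hj k i =>
    omega_testPair_of_strict hHD hI h₁ h₃ S V c hV 0 Γ (KΓ Γ) Sit hadm.1 hadm.2 hj (uOf k) (haOf Γ k) i

/-- **Kit #12's `hB` DISCHARGED** (line `1`), same data. -/
theorem hB_of_strict (KΓ : Level V → Subgroup (quotU V).G) {Kι : Type*} (uOf : Kι → stabilizer U21 x₀) (aOf : Kι → (V.latticeModel printFact_unitaryCompact_holds).G)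
    (haOf : ∀ (Γ : Level V) (k : Kι), aOf k ∈ KΓ Γ) :
    ∀ (Γ : Level V)
      (Sit : KTypeSituation ((𝕏).P 1) ((𝕏).ιinf Γ) ((𝕏).Δ Γ) (𝕏).κ₁ (𝕏).τ₁),
      (Sit.IsSaturated (KΓ Γ) ∧ Sit.IsStrict) → ∀ j ∈ Sit.𝓙, ∀ (k : Kι) (i : Fin 2),
        ((S V c).P 1).ω ((S V c).ιinf (uOf k : U21) * aOf k, 1) (j.1 (Sit.ι (LinearMap.proj i))) =
          ∑ l, (Jac (uOf k : U21) x₀) l i • j.1 (Sit.ι (LinearMap.proj l)) :=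
  fun Γ Sit hadm _ hj k i =>
    omega_testPair_of_strict hHD hI h₁ h₃ S V c hV 1 Γ (KΓ Γ) Sit hadm.1 hadm.2 hj (uOf k) (haOf Γ k) i

/-- **`hdet` in this parametrisation** (#V5 `det_Jac_x₀_eq_isotropyDetChar`): `det (Jac (uOf k) x₀) = isotropyDetChar (uOf k)`; kit #12's
`hdet : det (m k) = χ k` thus reads `χ k = isotropyDetChar (uOf k)` — (x-W)'s character. -/
theorem det_m_of_strict {Kι : Type*} (uOf : Kι → stabilizer U21 x₀) (k : Kι) :
    (Jac (uOf k : U21) x₀).det = (Literature.Geometry.ComplexHyperbolic.BallModel.isotropyDetChar (uOf k) : ℂ) :=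
  BallForms.det_Jac_x₀_eq_isotropyDetChar (uOf k)

end HodgeCM.Model

end
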